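/-
Origin: expansion seat `planner-pub-hodgecm-pv07-g2-0`, handover #4 2026-08-18T06:22:26Z (`HOME/pub-hodgecm-pv07-g2/lean/Pv07g2/DilationResIndex.lean`, md5 94618d45, 87 lines);
landed by the gen-6 packager in gate run 24 as `HodgeCM/PerL34/LocalFactors/DilationResIndex.lean` (import ^import Pv07g2\.→import HodgeCM.PerL34.LocalFactors. ×1; import ^import Pv13g3\.→import HodgeCM.PerL34. ×1).
-/
/-
Copyright: HodgeCM publication cell (pub-hodgecm), DAG node N31f/N31g — split places in the D4 dilation model
(prover lineage pv07, gen 2).  Released under the package licence.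

# Glue: the unramified split VALUE with `q := [𝒪 : ϖ𝒪]`, hypothesis-free

`DilationModulus.splitIntegrand_f_eqOn_shell_tOf` (pv07-g2, HANDOVER #3) computes the integrand of the
dilation-model datum `splitIntegrand μV 0 ρ μG ν χ'` on the shell `‖y‖ = ‖ϖ‖ᵏ` as
`(EulerProduct.tOf q)^{|k|} · (χ'(ϖ)ν(ϖ))ᵏ` under ONE displayed hypothesis
`hq : distribHaarChar F ϖ = (q : ℝ≥0)⁻¹` (Weil, *Basic Number Theory* I §4 Thm 6: `mod_K(π) = q⁻¹`).
pv13-g3's `LocalModulus.distribHaarChar_uniformizer` (HANDOVER 06:20:36Z, `HodgeCM.PerL34.LocalModulus`)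
PROVES that hypothesis in the kernel by coset counting, with `q := LocalModulus.resIndex ϖ = [𝒪 : ϖ𝒪]`,
and `LocalModulus.two_le_resIndex` gives `2 ≤ q` for `‖ϖ‖ < 1`.

This 1-screen file instantiates: **`splitIntegrand_f_eqOn_shell_resIndex`** — for a non-trivially normed
ultrametric proper field `F`, `φ⁰ = 1_B ⊂ F³` with `vol B = 1`, `ν, χ'` unramified and `‖ϖ‖ < 1`, on the
shell `‖y‖ = ‖ϖ‖ᵏ` the integrand IS `(tOf [𝒪:ϖ𝒪])^{|k|} · (χ'(ϖ)ν(ϖ))ᵏ` with NO displayed hypothesis, and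
`two_le_resIndex` re-exported next to it — i.e. the VALUE field `hF` and the side condition `two_le_q` of
pv09-g3's `UnramifiedPlaceData` / pv10's `split_AX7_shape` hold for the dilation-model datum as THEOREMS.
What remains PRINT at a split unramified place is the single D4 sentence (PerL's `ω_v|U(W_i)` is this model,
[MVW] LNM 1291 ch. 3 §III.1) and the bookkeeping `[𝒪_v : ϖ_v𝒪_v] = N(v)`.

Nothing is cited; no hypothesis names PerL, QW8 or a 2001-programme claim.  Axioms = the standard trio.
Unit `pub-hodgecm-pv07-g2`, 2026-08-18.
-/
import Summits.HodgeConjecture.HodgeCM.PerL34.LocalFactors.DilationModulus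
import Summits.HodgeConjecture.HodgeCM.PerL34.LocalModulus

/-! PORT of `HodgeCM/PerL34/LocalFactors/DilationResIndex.lean` (HodgeCMPerL run 82) — verbatim mechanical port; provenance in the PORT header line. -/

set_option autoImplicit false

noncomputable section

open MeasureTheory MeasureTheory.Measure Set Metric
open scoped NNReal ENNReal Pointwise

namespace HodgeCM
namespace PerL34
namespace LocalFactors
namespace DilationModel

section ResIndex

variable {F : Type} [NontriviallyNormedField F] [IsUltrametricDist F] [ProperSpace F]

/-- `t = shellParam 3 ϖ = tOf [𝒪 : ϖ𝒪]` for `‖ϖ‖ ≤ 1` — `shellParam_three_eq_tOf` with pv13-g3's kernel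
normalisation `distribHaarChar F ϖ = [𝒪 : ϖ𝒪]⁻¹`. -/
theorem shellParam_three_eq_tOf_resIndex (ϖ : Fˣ) (hϖ : ‖(ϖ : F)‖ ≤ 1) :
    ((shellParam 3 ϖ : ℝ≥0) : ℝ) = EulerProduct.tOf (LocalModulus.resIndex ϖ) :=
  shellParam_three_eq_tOf ϖ _ (LocalModulus.distribHaarChar_uniformizer hϖ)

/-- the side condition `2 ≤ q` of `UnramifiedPlaceData.two_le_q`, for `q := [𝒪 : ϖ𝒪]` and `‖ϖ‖ < 1`
(pv13-g3's `LocalModulus.two_le_resIndex`, re-exported here so the split unramified row reads off one file). -/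
theorem two_le_resIndex_of_norm_lt_one (ϖ : Fˣ) (hϖ : ‖(ϖ : F)‖ < 1) :
    2 ≤ LocalModulus.resIndex ϖ :=
  LocalModulus.two_le_resIndex hϖ

/-- `1 < q`, the form pv13's `EulerProduct` summability lemmas take (`tOf q < 1`). -/
theorem one_lt_resIndex_of_norm_lt_one (ϖ : Fˣ) (hϖ : ‖(ϖ : F)‖ < 1) :
    1 < LocalModulus.resIndex ϖ :=
  lt_of_lt_of_le one_lt_two (LocalModulus.two_le_resIndex hϖ)

attribute [local instance] unitsBorel borelSpace_units

variable [MeasurableSpace (Fin 3 → F)] [BorelSpace (Fin 3 → F)] (μV : Measure (Fin 3 → F)) [μV.IsAddHaarMeasure]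
  (ρ : ℝ) (ν : Fˣ →* Circle) (μG : Measure Fˣ) [μG.IsHaarMeasure] [μG.Regular] (χ' : Fˣ →* Circle)

/-- **Tex l. 629–630 in the dilation model, hypothesis-free.**  For `F³`, `φ⁰ = 1_B` with `vol(B) = 1`,
`ν` and `χ'` unramified and `‖ϖ‖ < 1`: on the shell `‖y‖ = ‖ϖ‖ᵏ` the integrand of
`splitIntegrand μV 0 ρ μG ν χ'` is the constant `(tOf q)^{|k|} · (χ'(ϖ)ν(ϖ))ᵏ` with `q := [𝒪 : ϖ𝒪]`
(`LocalModulus.resIndex ϖ`) — the VALUE in pv09-g3's `UnramifiedPlaceData.hF`. -/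
theorem splitIntegrand_f_eqOn_shell_resIndex (ϖ : Fˣ) (hϖ : ‖(ϖ : F)‖ < 1)
    (hν : ∀ u : Fˣ, ‖(u : F)‖ = 1 → ν u = 1) (hχ : ∀ u : Fˣ, ‖(u : F)‖ = 1 → χ' u = 1)
    (hvol : μV.real (closedBall (0 : Fin 3 → F) ρ) = 1) (k : ℤ) :
    EqOn (splitIntegrand μV 0 ρ μG ν χ').f
      (fun _ => ((EulerProduct.tOf (LocalModulus.resIndex ϖ) : ℝ) : ℂ) ^ k.natAbs *
        ((χ' ϖ : ℂ) * (ν ϖ : ℂ)) ^ k) (shell ϖ k) :=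
  splitIntegrand_f_eqOn_shell_tOf μV ρ ν μG χ' ϖ hϖ hν hχ hvol _
    (LocalModulus.distribHaarChar_uniformizer hϖ.le) k

end ResIndex

end DilationModel
end LocalFactors
end PerL34
end HodgeCM

end
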